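import Summits.QuantumFields.YangMills.Theorems.BalabanUVNodesSpineReadingOfRecord13CoPHKRatioDominationBankedChronoMargins
import Summits.QuantumFields.YangMills.Theorems.BalabanUVNodesN20FinalLevelBankedBudgetCells

/-!
# N20 (NE7b) ON THE TOWER-FREE ROAD, THE FACE OF RECORD: ✓`…BankedChronoMargins` §2 with the pins — birth cells := the boxes of the family's torus (`V = ℓ^4`, `Λ = L^4`, NO cell count,
# ✓p774413), flow block size := `F.L`, flow couplings := THE HISTORIES OF RECORD `histA₁₃ ∕ histB₁₃` read up to their level (so the nonnegative-profile binder is a consequence of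
# `1 ≤ log g_s⁻²` and GONE); displayed after this file: (a) the letters, (b) data + labels, (ID) multiplicities + caps, the typed flow (2.7) ∕ (2.9) ∕ (2.5) OF THE HISTORIES OF RECORD with
# `1 ≤ log g_s⁻²` up to the level and the infrared smallness `x₀ ≤ log g⁻²` AT the level, the cut — nothing else

Cell `pub-ymgap`, YM-PLAN Track A (HUMAN RULING D-0062); seat `pub-ymgap-dag-n20-d` (R134 (a) N20 NE7b s3), gen 42 — director-ym №374 line (E), road [e] TOWER-FREE of record (№377).
`--kind proof --supports stmt-QuantumFields-27366 --as helper` (K3⁸); COUNT-NEUTRAL; THEOREMS ONLY (0 `def`).  [LF-II] = [Balaban1989LargeFieldII]; [III] = [Balaban1988Convergent].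
Companions BY NAME: `…BankedChronoMargins.exists_margins_irThreshold_relWeightBound_chronoGenealogies` (gen 42), `…N20FinalLevelBankedBudgetCells.card_boxCells_le` (gen 40, p774413),
the CoPHK carriers `runA₁₃ ∕ runB₁₃ ∕ histA₁₃ ∕ histB₁₃ ∕ classSetK₁₃ ∕ weightAK₁₃ ∕ weightBK₁₃ ∕ badClassK₁₃` (gen 28 ∕ 29), `B14.{FlowIneq27, IsRj}`, `B14FlowStep.FlowIneq29`.

WHY.  ✓`…BankedChronoMargins` left the cells `#Cell a ≤ V·Λ^a`, the flow couplings `g K` and a nonnegative profile `0 ≤ p₀(g K j)` for ALL `j` displayed.  At the carriers of record the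
cells ARE the `ℓ^4·(L^4)^a` boxes of the torus (p774413, kernel count), and the couplings ARE the histories of record; the typed (2.7) ∕ (2.9) ∕ (2.5) [III] at level `K₀ + K` read steps
`≤ K₀ + K` only (§1 `flowIneq27_readUpTo`, `flowIneq29_readUpTo`), so the history may be read up to the level, `j ↦ histA₁₃ θ K₀ g₀ K (min j (K₀ + K))`, where `1 ≤ log g_s⁻²` makes the
profile `A₀·(log g_s⁻²)^{p₀}` nonnegative EVERYWHERE — the binder disappears.  Run B at cutoff `K` lives at level `K₀ + K + 1`, and `histB₁₃ θ K₀ g₀ K` IS `histA₁₃ θ K₀ g₀ (K + 1)` (`rfl`).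

WHAT IS PROVED (kernel; zero `sorry`).  §1 `flowIneq27_readUpTo`, `flowIneq29_readUpTo`.  §2 ★★★ `exists_margins_irThreshold_relWeightBound_chronoGenealogies_ofRecord`.

WHAT STAYS DISPLAYED (the census of road [e] at the carriers of record after this file; NOT PRINTED as theorems of [LF-II] for `d = 4`, NOT proved here): (a) the fibrewise letters with
good images and the factor clause `z s ≤ Π_{Y ∈ φ σ s} e^{−credits(G Y)}·e^{+lifeCost(G Y)}` in `C₀`'s raw factors of the level-read history of record (an ESTIMATE; junction NC-NE7b-α
UNRULED; `pub-balaban`'s R3′); (b) removal maps, fibre injections, slot filing into the boxes, and the genealogy LABELS (consistent ∕ well-formed ∕ pending ∕ chronological ∕ within the caps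
∕ rooted at the slot) — a DEFINER object on def-T's index (post-campaign design memo per №374); (ID) the fibre multiplicities `#fibre(slot, shape) ≤ M^{partnerAges}` and the caps; the
window sequences `R K` and slopes `β′ K` with which the histories of record obey (2.7) ∕ (2.9) ∕ (2.5), `1 ≤ log g_s⁻²` up to the level, `x₀ ≤ log g⁻²` at the level (the node owners of the
flow); the cut `j⋆` with its fraction `c`; that the boxes ARE the birth cells and `C₀` print's constants is READING (ID).

HONEST FRAMING.  [bookkeeping]: two three-line flow readings and one composition; no estimate.  NOTHING of Bałaban's is asserted; NO weight of Bałaban's is bounded; NE7 ∕ NE7b ∕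
NE7c NOT PRINTED for `d = 4` ∕ NOT proved; no `Provisos₁₃CoPH` inhabitant claimed (K0⁷ OPEN); K3⁸ untouched; N20 NOT discharged; counts UNMOVED (typed 28∕28 · discharged 8∕27); one
finite four-torus programme at fixed `ε` — NOT ℝ⁴, NOT OS, NOT a mass gap, NOT the Clay problem.  No `def`, no `instance`, no `notation`, no `sorry`; no decl below carries a cite tag.
-/

noncomputable section

open MeasureTheory
open scoped BigOperators
open Finset

namespace YMDAG.UVSplit

open Literature.MathematicalPhysics.QuantumFieldTheory.Balaban1983to89
open Literature.MathematicalPhysics.QuantumFieldTheory.Balaban1983to89.T4Continuum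
open Literature.MathematicalPhysics.QuantumFieldTheory.Balaban1983to89.Node00
open Literature.MathematicalPhysics.QuantumFieldTheory.Balaban1983to89.B15.BasicStep (fibreIntegral)
open T4WeightBudget (RelWeightBound)
open T4PersistenceDictionary (Gen PEv dictW)
open T4BankedInduction (Banking credits lifeCost)
open T4PartnerMultiplicity (partnerAges)
open T4BranchingRecordsGas (relabel shape)
open T4PrintedShapeBanking (Consistent)
open T4CanonicalMenus (Chrono fuel canonFam birthMass birthMass_nonneg)

variable {F : T4Family} {N : ℕ} [NeZero N]

/-! ## §1 The typed flow letters read a history only up to their level -/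

section ReadUpTo

/-- (2.7) at level `L` reads the couplings at steps `≤ L` only: it holds for the history read up to the level `j ↦ g (min j L)` once it holds for `g`. [bookkeeping] -/
theorem flowIneq27_readUpTo {g : ℕ → ℝ} {β' β₀ : ℝ} {p L : ℕ} (h : B14.FlowIneq27 g β' β₀ p L) : B14.FlowIneq27 (fun j => g (min j L)) β' β₀ p L := by
  intro m n hmn hn
  have hm : min m L = m := Nat.min_eq_left (by omega)
  have hn' : min n L = n := Nat.min_eq_left hn
  simp only [hm, hn']
  exact h m n hmn hn

/-- (2.9) at level `L` reads the couplings at steps `≤ L` only. [bookkeeping] -/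
theorem flowIneq29_readUpTo {R : ℕ → ℕ} {g : ℕ → ℝ} {Lb : ℕ} {β' β₀ : ℝ} {L : ℕ} (h : B14FlowStep.FlowIneq29 R g Lb β' β₀ L) :
    B14FlowStep.FlowIneq29 R (fun j => g (min j L)) Lb β' β₀ L := by
  intro m n hmn hn
  have hn' : min n L = n := Nat.min_eq_left hn
  simp only [hn']
  exact h m n hmn hn

end ReadUpTo

/-! ## §2 The face OF RECORD: birth cells := the boxes of the family's torus, flow couplings := the histories of record (read up to the level), margins chosen -/

section OfRecord

open scoped Classical in
/-- ★★★ **THE N20 FACE ON THE TOWER-FREE ROAD, OF RECORD** (✓`exists_margins_irThreshold_relWeightBound_chronoGenealogies` with the pins): the birth cells of age `a` := the boxes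
`Fin 4 → range(ℓ·L^a)` of the family's torus (`ℓ = 2L^m` unit blocks; EXACTLY `ℓ^4·(L^4)^a` of them, ✓p774413 `card_boxCells_le` — NO cell-count hypothesis; `V = ℓ^4`, `Λ = L^4`); the
flow's block size := `F.L`; the flow couplings at level `K₀ + K` := run A's HISTORY OF RECORD `histA₁₃ θ K₀ g₀ K` READ UP TO THE LEVEL (`j ↦ histA₁₃ θ K₀ g₀ K (min j (K₀ + K))`: the
typed flow letters only read steps `≤` the level, §1, and so do the credits of consistent labels; the clamp makes the nonnegative-profile binder of ✓`…BankedChrono` a CONSEQUENCE of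
`1 ≤ log g_s⁻²`, so it is GONE; run B at cutoff `K` reads `histB₁₃ θ K₀ g₀ K`, which IS `histA₁₃ θ K₀ g₀ (K + 1)`); the margins `κ₁, E₀` CHOSEN.  For print's valid constants `C₀`
(`a, A₀, μ > 0`), `β₀ ≥ 0`, `r(q′+1) < p₀`, ANY `M ≥ 0` and `η̄₊ > 0`: `∃ κ₁ E₀ x₀`, `κ₁, E₀ ≥ 0`, `L^4·e^{η̄₊−κ₁} < 1`, such that for every rank, carrier tuple `(θ, hP, K₀, g₀, os, kr, bd)`,
cut, window sequences `R K` and slopes `β′ K` with which THE HISTORIES OF RECORD obey the typed (2.7) ∕ (2.9) ∕ (2.5) up to the level with `1 ≤ log g_s⁻²` there and `x₀ ≤ log g⁻²` AT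
the level, caps, displayed measurability ∕ integrability, and per `(K, t)` EACH RUN's letters (a) (credits of the level-read history in `C₀`'s raw factors), data and labels (b),
multiplicities (ID) ⇒ `RelWeightBound 1 … (K ↦ 1 − exp(−S_K))`, `S_K = birthMass C₀·e^{−κ₁}·ℓ^4·r^{K − j⋆(K) + 1}∕(1 − r)`, `r = L^4·e^{η̄₊−κ₁}`. [bookkeeping] -/
theorem exists_margins_irThreshold_relWeightBound_chronoGenealogies_ofRecord {X : Type*} (C₀ : T4PrintedShapeBanking.Consts) (hCv : C₀.Valid) (ha : 0 < C₀.a)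
    (hA : 0 < C₀.A₀) (hμ₀ : 0 < C₀.μ) {r : ℕ} {β₀ : ℝ} (hβ : 0 ≤ β₀) (hrq : r * (C₀.q' + 1) < C₀.p₀) {M ηplus : ℝ} (hM : 0 ≤ M) (hη : 0 < ηplus) :
    ∃ κ₁ E₀ x₀ : ℝ, 0 ≤ κ₁ ∧ 0 ≤ E₀ ∧ (F.L : ℝ) ^ 4 * Real.exp (ηplus - κ₁) < 1 ∧
      ∀ {N : ℕ} [NeZero N] (θ : Stage13HParams F N) (hP : θ.Provisos₁₃CoPH F N) (K₀ : ℕ) (g₀ : ℕ → ℝ) (os : List (ULoop F))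
      (kr : ℕ → (Σ K, SiteSeqKey F (K₀ + K)) → (Σ K, SiteSeqKey F (K₀ + K))) (bd : ℕ → (Σ K, SiteSeqKey F (K₀ + K)) → Prop) (c : ℝ), 0 < c →
      ∀ (jstar : ℕ → ℕ), (∀ K, jstar K ≤ K) → (∀ K : ℕ, c * K ≤ ((K - jstar K : ℕ) : ℝ)) →
      ∀ (R : ℕ → ℕ → ℕ) (β' : ℕ → ℝ),
        (∀ K, B14.FlowIneq27 (histA₁₃ θ K₀ g₀ K) (β' K) β₀ C₀.p₀ (K₀ + K)) → (∀ K, B14FlowStep.FlowIneq29 (R K) (histA₁₃ θ K₀ g₀ K) F.L (β' K) β₀ (K₀ + K)) →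
        (∀ K s, s ≤ K₀ + K → B14.IsRj F.L r (histA₁₃ θ K₀ g₀ K s) (R K s)) → (∀ K s, s ≤ K₀ + K → 1 ≤ Real.log ((histA₁₃ θ K₀ g₀ K s) ^ 2)⁻¹) →
        (∀ K, x₀ ≤ Real.log ((histA₁₃ θ K₀ g₀ K (K₀ + K)) ^ 2)⁻¹) →
      ∀ (Dcap Ncap : ℕ → ℕ),
      (∀ K t s, Measurable fun V => chiSeqOfRecord F N θ.ν θ.τ9.M (histA₁₃ θ K₀ g₀ K) (K₀ + K) (K₀ + K) s V *
        dressedSlotsOfDatum₉ F N θ.toStage9Params (datumOfRecord₁₃CoPH F N θ hP) g₀ os t (runA₁₃ F K₀ g₀ K) (histA₁₃ θ K₀ g₀ K) (K₀ + K) s V) →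
      (∀ K t s, Integrable (fun V => chiSeqOfRecord F N θ.ν θ.τ9.M (histA₁₃ θ K₀ g₀ K) (K₀ + K) (K₀ + K) s V *
        dressedSlotsOfDatum₉ F N θ.toStage9Params (datumOfRecord₁₃CoPH F N θ hP) g₀ os t (runA₁₃ F K₀ g₀ K) (histA₁₃ θ K₀ g₀ K) (K₀ + K) s V)
        (fieldMeasure (F.P (K₀ + K)) (K₀ + K) (SU N))) →
      (∀ K t s', Measurable fun V => chiSeqOfRecord F N θ.ν θ.τ9.M (histB₁₃ θ K₀ g₀ K) (K₀ + K + 1) (K₀ + K + 1) s' V *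
        dressedSlotsOfDatum₉ F N θ.toStage9Params (datumOfRecord₁₃CoPH F N θ hP) g₀ os t (runB₁₃ F K₀ g₀ K) (histB₁₃ θ K₀ g₀ K) (K₀ + K + 1) s' V) →
      (∀ K t s', Integrable (fun V => chiSeqOfRecord F N θ.ν θ.τ9.M (histB₁₃ θ K₀ g₀ K) (K₀ + K + 1) (K₀ + K + 1) s' V *
        dressedSlotsOfDatum₉ F N θ.toStage9Params (datumOfRecord₁₃CoPH F N θ hP) g₀ os t (runB₁₃ F K₀ g₀ K) (histB₁₃ θ K₀ g₀ K) (K₀ + K + 1) s' V)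
        (fieldMeasure (F.P (K₀ + K + 1)) (K₀ + K + 1) (SU N))) →
      (∀ (K : ℕ) (t : ℝ), |t| ≤ 1 →
        ∃ (rm : SeqOfRecord F θ.ν θ.τ9.M (histA₁₃ θ K₀ g₀ K) (K₀ + K) (K₀ + K) → SeqOfRecord F θ.ν θ.τ9.M (histA₁₃ θ K₀ g₀ K) (K₀ + K) (K₀ + K))
          (fib : SeqOfRecord F θ.ν θ.τ9.M (histA₁₃ θ K₀ g₀ K) (K₀ + K) (K₀ + K) → Finset (PBond (F.P (K₀ + K)) (K₀ + K)))
          (z : SeqOfRecord F θ.ν θ.τ9.M (histA₁₃ θ K₀ g₀ K) (K₀ + K) (K₀ + K) → ℝ) (Old : SeqOfRecord F θ.ν θ.τ9.M (histA₁₃ θ K₀ g₀ K) (K₀ + K) (K₀ + K) → Finset X)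
          (φ : SeqOfRecord F θ.ν θ.τ9.M (histA₁₃ θ K₀ g₀ K) (K₀ + K) (K₀ + K) → SeqOfRecord F θ.ν θ.τ9.M (histA₁₃ θ K₀ g₀ K) (K₀ + K) (K₀ + K) → Finset X)
          (slot : X → (Σ _ : ℕ, (Fin 4 → ℕ))) (G : X → Gen PEv),
          (∀ s, kr K (keyA₁₃ θ K₀ g₀ K s) ∈ badClassK₁₃ θ K₀ g₀ kr bd K t → ∀ V,
            fibreIntegral (fib s) (fun V => chiSeqOfRecord F N θ.ν θ.τ9.M (histA₁₃ θ K₀ g₀ K) (K₀ + K) (K₀ + K) s V *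
                dressedSlotsOfDatum₉ F N θ.toStage9Params (datumOfRecord₁₃CoPH F N θ hP) g₀ os t (runA₁₃ F K₀ g₀ K) (histA₁₃ θ K₀ g₀ K) (K₀ + K) s V) V ≤
              z s * fibreIntegral (fib s) (fun V => chiSeqOfRecord F N θ.ν θ.τ9.M (histA₁₃ θ K₀ g₀ K) (K₀ + K) (K₀ + K) (rm s) V *
                dressedSlotsOfDatum₉ F N θ.toStage9Params (datumOfRecord₁₃CoPH F N θ hP) g₀ os t (runA₁₃ F K₀ g₀ K) (histA₁₃ θ K₀ g₀ K) (K₀ + K) (rm s) V) V) ∧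
          (∀ s, kr K (keyA₁₃ θ K₀ g₀ K s) ∈ badClassK₁₃ θ K₀ g₀ kr bd K t → kr K (keyA₁₃ θ K₀ g₀ K (rm s)) ∉ badClassK₁₃ θ K₀ g₀ kr bd K t) ∧
          (∀ σ s, kr K (keyA₁₃ θ K₀ g₀ K s) ∈ badClassK₁₃ θ K₀ g₀ kr bd K t → rm s = σ → φ σ s ⊆ Old σ ∧ (φ σ s).Nonempty) ∧
          (∀ σ, Set.InjOn (φ σ) {s | kr K (keyA₁₃ θ K₀ g₀ K s) ∈ badClassK₁₃ θ K₀ g₀ kr bd K t ∧ rm s = σ}) ∧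
          (∀ σ s, kr K (keyA₁₃ θ K₀ g₀ K s) ∈ badClassK₁₃ θ K₀ g₀ kr bd K t → rm s = σ →
            z s ≤ ∏ Y ∈ φ σ s, Real.exp (-credits (T4PrintedShapeBanking.credit C₀ (fun j => histA₁₃ θ K₀ g₀ K (min j (K₀ + K)))) (G Y)) *
              Real.exp (lifeCost (dictW (R K) C₀.n₁) (T4PrintedShapeBanking.cost C₀ (K₀ + K) (R K)) (G Y))) ∧
          (∀ σ, ∀ Y ∈ Old σ, (slot Y).1 < K₀ + jstar K) ∧
          (∀ σ, ∀ Y ∈ Old σ, (slot Y).2 ∈ Fintype.piFinset fun _ : Fin 4 => Finset.range (2 * F.L ^ F.m * F.L ^ ((K₀ + K) - (slot Y).1))) ∧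
          (∀ σ, ∀ Y ∈ Old σ, Consistent C₀ (K₀ + K) (R K) (G Y)) ∧ (∀ σ, ∀ Y ∈ Old σ, (G Y).WF (dictW (R K) C₀.n₁)) ∧
          (∀ σ, ∀ Y ∈ Old σ, K₀ + K < (G Y).reach (dictW (R K) C₀.n₁)) ∧ (∀ σ, ∀ Y ∈ Old σ, Chrono PEv.step (G Y)) ∧
          (∀ σ, ∀ Y ∈ Old σ, ∀ e ∈ (G Y).events, e.kind = 0 → e.fat < Dcap (K₀ + K)) ∧ (∀ σ, ∀ Y ∈ Old σ, fuel (G Y) ≤ Ncap (K₀ + K)) ∧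
          (∀ σ, ∀ Y ∈ Old σ, (G Y).rootStep = (slot Y).1) ∧
          (∀ σ, ∀ j < K₀ + jstar K, ∀ zc ∈ (Fintype.piFinset fun _ : Fin 4 => Finset.range (2 * F.L ^ F.m * F.L ^ ((K₀ + K) - j))),
            ∀ G₀ ∈ canonFam Dcap Ncap (K₀ + K) j,
            ((((Old σ).filter fun Y => slot Y = ⟨j, zc⟩ ∧ relabel shape (G Y) = G₀).card : ℕ) : ℝ) ≤ M ^ partnerAges PEv.step G₀)) →
      (∀ (K : ℕ) (t : ℝ), |t| ≤ 1 →
        ∃ (rm : SeqOfRecord F θ.ν θ.τ9.M (histB₁₃ θ K₀ g₀ K) (K₀ + K + 1) (K₀ + K + 1) → SeqOfRecord F θ.ν θ.τ9.M (histB₁₃ θ K₀ g₀ K) (K₀ + K + 1) (K₀ + K + 1))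
          (fib : SeqOfRecord F θ.ν θ.τ9.M (histB₁₃ θ K₀ g₀ K) (K₀ + K + 1) (K₀ + K + 1) → Finset (PBond (F.P (K₀ + K + 1)) (K₀ + K + 1)))
          (z : SeqOfRecord F θ.ν θ.τ9.M (histB₁₃ θ K₀ g₀ K) (K₀ + K + 1) (K₀ + K + 1) → ℝ)
          (Old : SeqOfRecord F θ.ν θ.τ9.M (histB₁₃ θ K₀ g₀ K) (K₀ + K + 1) (K₀ + K + 1) → Finset X)
          (φ : SeqOfRecord F θ.ν θ.τ9.M (histB₁₃ θ K₀ g₀ K) (K₀ + K + 1) (K₀ + K + 1) → SeqOfRecord F θ.ν θ.τ9.M (histB₁₃ θ K₀ g₀ K) (K₀ + K + 1) (K₀ + K + 1) → Finset X)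
          (slot : X → (Σ _ : ℕ, (Fin 4 → ℕ))) (G : X → Gen PEv),
          (∀ s', kr K (keyB₁₃ θ K₀ g₀ K s') ∈ badClassK₁₃ θ K₀ g₀ kr bd K t → ∀ V,
            fibreIntegral (fib s') (fun V => chiSeqOfRecord F N θ.ν θ.τ9.M (histB₁₃ θ K₀ g₀ K) (K₀ + K + 1) (K₀ + K + 1) s' V *
                dressedSlotsOfDatum₉ F N θ.toStage9Params (datumOfRecord₁₃CoPH F N θ hP) g₀ os t (runB₁₃ F K₀ g₀ K) (histB₁₃ θ K₀ g₀ K) (K₀ + K + 1) s' V) V ≤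
              z s' * fibreIntegral (fib s') (fun V => chiSeqOfRecord F N θ.ν θ.τ9.M (histB₁₃ θ K₀ g₀ K) (K₀ + K + 1) (K₀ + K + 1) (rm s') V *
                dressedSlotsOfDatum₉ F N θ.toStage9Params (datumOfRecord₁₃CoPH F N θ hP) g₀ os t (runB₁₃ F K₀ g₀ K) (histB₁₃ θ K₀ g₀ K) (K₀ + K + 1) (rm s') V) V) ∧
          (∀ s', kr K (keyB₁₃ θ K₀ g₀ K s') ∈ badClassK₁₃ θ K₀ g₀ kr bd K t → kr K (keyB₁₃ θ K₀ g₀ K (rm s')) ∉ badClassK₁₃ θ K₀ g₀ kr bd K t) ∧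
          (∀ σ s', kr K (keyB₁₃ θ K₀ g₀ K s') ∈ badClassK₁₃ θ K₀ g₀ kr bd K t → rm s' = σ → φ σ s' ⊆ Old σ ∧ (φ σ s').Nonempty) ∧
          (∀ σ, Set.InjOn (φ σ) {s' | kr K (keyB₁₃ θ K₀ g₀ K s') ∈ badClassK₁₃ θ K₀ g₀ kr bd K t ∧ rm s' = σ}) ∧
          (∀ σ s', kr K (keyB₁₃ θ K₀ g₀ K s') ∈ badClassK₁₃ θ K₀ g₀ kr bd K t → rm s' = σ →
            z s' ≤ ∏ Y ∈ φ σ s', Real.exp (-credits (T4PrintedShapeBanking.credit C₀ (fun j => histB₁₃ θ K₀ g₀ K (min j (K₀ + K + 1)))) (G Y)) *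
              Real.exp (lifeCost (dictW (R (K + 1)) C₀.n₁) (T4PrintedShapeBanking.cost C₀ (K₀ + K + 1) (R (K + 1))) (G Y))) ∧
          (∀ σ, ∀ Y ∈ Old σ, (slot Y).1 < K₀ + jstar K + 1) ∧
          (∀ σ, ∀ Y ∈ Old σ, (slot Y).2 ∈ Fintype.piFinset fun _ : Fin 4 => Finset.range (2 * F.L ^ F.m * F.L ^ ((K₀ + K + 1) - (slot Y).1))) ∧
          (∀ σ, ∀ Y ∈ Old σ, Consistent C₀ (K₀ + K + 1) (R (K + 1)) (G Y)) ∧ (∀ σ, ∀ Y ∈ Old σ, (G Y).WF (dictW (R (K + 1)) C₀.n₁)) ∧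
          (∀ σ, ∀ Y ∈ Old σ, K₀ + K + 1 < (G Y).reach (dictW (R (K + 1)) C₀.n₁)) ∧ (∀ σ, ∀ Y ∈ Old σ, Chrono PEv.step (G Y)) ∧
          (∀ σ, ∀ Y ∈ Old σ, ∀ e ∈ (G Y).events, e.kind = 0 → e.fat < Dcap (K₀ + K + 1)) ∧ (∀ σ, ∀ Y ∈ Old σ, fuel (G Y) ≤ Ncap (K₀ + K + 1)) ∧
          (∀ σ, ∀ Y ∈ Old σ, (G Y).rootStep = (slot Y).1) ∧
          (∀ σ, ∀ j < K₀ + jstar K + 1, ∀ zc ∈ (Fintype.piFinset fun _ : Fin 4 => Finset.range (2 * F.L ^ F.m * F.L ^ ((K₀ + K + 1) - j))),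
            ∀ G₀ ∈ canonFam Dcap Ncap (K₀ + K + 1) j,
            ((((Old σ).filter fun Y => slot Y = ⟨j, zc⟩ ∧ relabel shape (G Y) = G₀).card : ℕ) : ℝ) ≤ M ^ partnerAges PEv.step G₀)) →
      RelWeightBound 1 (classSetK₁₃ θ K₀ g₀ kr) (weightAK₁₃ θ hP K₀ g₀ os kr) (weightBK₁₃ θ hP K₀ g₀ os kr) (badClassK₁₃ θ K₀ g₀ kr bd)
        (fun K => 1 - Real.exp (-(birthMass C₀ * Real.exp (-κ₁) * (((2 * F.L ^ F.m : ℕ) : ℝ) ^ 4) *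
          ((((F.L : ℝ) ^ 4) * Real.exp (ηplus - κ₁)) ^ (K - jstar K + 1) / (1 - ((F.L : ℝ) ^ 4) * Real.exp (ηplus - κ₁)))))) := by
  have hL : 1 ≤ F.L := F.hL.2.le
  have hΛ : (0 : ℝ) < (F.L : ℝ) ^ 4 := by
    have : (0 : ℝ) < F.L := by exact_mod_cast (lt_trans Nat.zero_lt_one F.hL.2)
    positivity
  obtain ⟨κ₁, E₀, x₀, hκ, hE, hr, hx₀⟩ :=
    exists_margins_irThreshold_relWeightBound_chronoGenealogies (X := X) (γ := Fin 4 → ℕ) C₀ hCv ha hA hμ₀ hL hβ hrq hM hΛ hη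
  refine ⟨κ₁, E₀, x₀, hκ, hE, hr, ?_⟩
  intro N _ θ hP K₀ g₀ os kr bd c hc jstar hjK hfrac R β' h27 h29 hR hx1 hxK Dcap Ncap hmA hintA hmB hintB hLA hLB
  have hV : (0 : ℝ) ≤ ((2 * F.L ^ F.m : ℕ) : ℝ) ^ 4 := by positivity
  have hprof : ∀ K j, 0 ≤ p0Profile C₀.A₀ C₀.p₀ (histA₁₃ θ K₀ g₀ K (min j (K₀ + K))) := by
    intro K j
    have h1 : 1 ≤ Real.log ((histA₁₃ θ K₀ g₀ K (min j (K₀ + K))) ^ 2)⁻¹ := hx1 K _ (Nat.min_le_right _ _)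
    unfold p0Profile
    exact mul_nonneg hA.le (pow_nonneg (by linarith) _)
  exact hx₀ θ hP K₀ g₀ os kr bd _ c hV hc jstar hjK hfrac (fun a => Fintype.piFinset fun _ : Fin 4 => Finset.range (2 * F.L ^ F.m * F.L ^ a))
    (card_boxCells_le 4 (2 * F.L ^ F.m) F.L) R (fun K j => histA₁₃ θ K₀ g₀ K (min j (K₀ + K))) β' (fun K => flowIneq27_readUpTo (h27 K))
    (fun K => flowIneq29_readUpTo (h29 K)) (fun K s hs => by rw [Nat.min_eq_left hs]; exact hR K s hs)
    (fun K s hs => by rw [Nat.min_eq_left hs]; exact hx1 K s hs) (fun K => by rw [Nat.min_self]; exact hxK K) hprof Dcap Ncap hmA hintA hmB hintB hLA hLB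

end OfRecord

end YMDAG.UVSplit
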